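import Summits.AtomisticToContinuum.HydrodynamicLimit.Theorems.CollisionIsometryCLTMacroClosureTwoScaleDefs
import Summits.AtomisticToContinuum.HydrodynamicLimit.Theorems.CollisionIsometryCLTMacroClosureTwoScaleJensen
import Summits.AtomisticToContinuum.HydrodynamicLimit.Theorems.CollisionIsometryCLTMacroClosureTwoScaleTiling
import Summits.AtomisticToContinuum.HydrodynamicLimit.Theses.StiffCollisionalRelaxation
import HarnessLib

/-!
# Two-scale block MGF (line `IdeatorTwoGen1Sketch`, crux `MacroClosure`, stmt-AtomisticToContinuum-14870):
# the pointwise reduction to the cells of shifted tilings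

Support file (`--supports stmt-AtomisticToContinuum-14870`) of the line lead (continuation c2) towards the registered
stub `Barycentric.stub_blockMGF_twoScale`: for ONE configuration whose cubes of side `ℓ = 1/M` all hold at least two
particles and fewer than `1.1 σ⁻³ (N+1)ℓ³`, with pairwise distinct velocities,
`exp(γ'(N+1) ∫ₓ h⁺(Ū_{b_ℓ ⋆ ψ_{ℓ/8}}(z, x) | U_c) dx) ≤ ∫ₓ Π_κ exp(γ'(N+1)ℓ³ confRate(n_κ/((N+1)ℓ³))) exp(γ' cellKin_κ) dx`,
the cells `κ` being those of the `x`-shifted tiling: the landed integrated Jensen inequality (`stub_twoScale_jensen`)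
replaces the box-smoothed blocks by box blocks, the landed tiling average (`stub_twoScale_tiling`) turns the torus
integral into an integral of cell products, and the exact splitting of the box Bregman density into its
configurational and kinetic parts (the two rates, hypotheses here in their registered forms) identifies each factor.
-/

noncomputable section

open MeasureTheory Filter Set Topology InformationTheory
open scoped ENNReal ContDiff Convolution

namespace Summit.AtomisticToContinuum.HydrodynamicLimit.Theorems.MacroClosureLine

open Literature.MathematicalPhysics.KineticTheory Literature.Analysis.FluidPDE
open Literature.Analysis.FunctionSpaces
open Summit.AtomisticToContinuum.HydrodynamicLimit.Theses

namespace Barycentric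

namespace BlockMGFTwoScale

/-- **The pointwise reduction to the cells of shifted tilings** (core, abstract mesh `M` and side `ℓ = 1/M`). See the
module docstring; the splitting of the box Bregman density (`hRid`) and the non-negativity of `confRate` on the band
(`hRb`) are hypotheses in their registered forms. [folklore] -/
theorem pointwise_core : ∀ (N M : ℕ), 0 < M → ∀ (ℓ : ℝ), ℓ = ((M : ℕ) : ℝ)⁻¹ → ℓ ≤ 1 →
    StiffCollisionalRelaxation.HsFreeEnergyConvex → ∀ (σ : ℝ), 0 < σ → ∀ (uc : V3) (θc : ℝ),
    (∀ r : ℝ, 0 < r → r * σ ^ 3 < 11 / 10 → 0 ≤ confRate σ uc θc r) →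
    (∀ (N : ℕ) (ℓ : ℝ), 0 < ℓ → ∀ (z : Config (N + 1) (Fin 3) T3) (y : T3),
      (∃ i ∈ cellSet ℓ z y, ∃ j ∈ cellSet ℓ z y, (z i).2 ≠ (z j).2) →
      ((N : ℝ) + 1) * ℓ ^ 3 * relEnt σ (bU (boxKernel ℓ) z y) (stateOf 1 uc θc) =
        ((N : ℝ) + 1) * ℓ ^ 3 * confRate σ uc θc ((cellCount ℓ z y : ℝ) / (((N : ℝ) + 1) * ℓ ^ 3)) +
          cellKin uc θc ℓ z y ∧
      0 ≤ cellKin uc θc ℓ z y) →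
    ∀ (γ' : ℝ), 0 ≤ γ' → ∀ (z : Config (N + 1) (Fin 3) T3), (∀ i j, i ≠ j → (z i).2 ≠ (z j).2) →
    (∀ y, 2 ≤ cellCount ℓ z y) →
    (∀ y, (cellCount ℓ z y : ℝ) * σ ^ 3 < 11 / 10 * (((N : ℝ) + 1) * ℓ ^ 3)) →
    ENNReal.ofReal (Real.exp (γ' * ((N : ℝ) + 1) *
        ∫ x, max 0 (relEnt σ (bU (boxKernel ℓ ⋆ (Torus.kernel (ℓ / 8) : T3 → ℝ)) z x) (stateOf 1 uc θc)))) ≤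
      ∫⁻ x, ∏ κ : Fin 3 → Fin M, (ENNReal.ofReal (Real.exp (γ' * (((N : ℝ) + 1) * ℓ ^ 3) *
          confRate σ uc θc ((cellCount ℓ z (x + Torus.proj (Torus.cellCorner M κ)) : ℝ) /
            (((N : ℝ) + 1) * ℓ ^ 3)))) *
        ENNReal.ofReal (Real.exp (γ' * cellKin uc θc ℓ z (x + Torus.proj (Torus.cellCorner M κ))))) := by
  intro N M hM ℓ hℓM hℓ1 hH σ hσ uc θc hRb hRid γ' hγ' z hv h2 hpack
  have hMR : (0 : ℝ) < (M : ℕ) := Nat.cast_pos.2 hM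
  have hℓpos : 0 < ℓ := by rw [hℓM]; exact inv_pos.2 hMR
  set V : ℝ := ((N : ℝ) + 1) * ℓ ^ 3 with hV
  have hV0 : 0 < V := by positivity
  set g : T3 → ℝ := fun x => max 0 (relEnt σ (bU (boxKernel ℓ) z x) (stateOf 1 uc θc)) with hg
  -- Jensen, integrated
  obtain ⟨hJ, hgi⟩ := stub_twoScale_jensen hH σ hσ uc θc N ℓ (ℓ / 8) hℓpos hℓ1 (by positivity)
    (by linarith) z hv h2 hpack
  have hg0 : ∀ x, 0 ≤ g x := fun x => le_max_left _ _
  -- the tiling average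
  have hT := stub_twoScale_tiling M hM g hgi hg0 (γ' * ((N : ℝ) + 1)) (by positivity)
  -- the splitting of each cell factor
  have key : ∀ y : T3, ENNReal.ofReal (Real.exp (γ' * ((N : ℝ) + 1) / (M : ℝ) ^ 3 * g y)) =
      ENNReal.ofReal (Real.exp (γ' * V * confRate σ uc θc ((cellCount ℓ z y : ℝ) / V))) *
        ENNReal.ofReal (Real.exp (γ' * cellKin uc θc ℓ z y)) := by
    intro y
    -- two distinct velocities in the cell
    obtain ⟨a, ha, b, hb, hab⟩ := Finset.one_lt_card.1 (lt_of_lt_of_le one_lt_two (h2 y))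
    obtain ⟨hid, hkin⟩ := hRid N ℓ hℓpos z y ⟨a, ha, b, hb, hv a b hab⟩
    -- non-negativity of the Bregman density
    have hn : (2 : ℝ) ≤ (cellCount ℓ z y : ℝ) := by exact_mod_cast h2 y
    have hr : 0 < (cellCount ℓ z y : ℝ) / V := div_pos (by linarith) hV0
    have hrσ : (cellCount ℓ z y : ℝ) / V * σ ^ 3 < 11 / 10 := by
      rw [div_mul_eq_mul_div, div_lt_iff₀ hV0]; exact hpack y
    have hconf : 0 ≤ confRate σ uc θc ((cellCount ℓ z y : ℝ) / V) := hRb _ hr hrσ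
    have hrel : 0 ≤ relEnt σ (bU (boxKernel ℓ) z y) (stateOf 1 uc θc) := by
      have : 0 ≤ V * relEnt σ (bU (boxKernel ℓ) z y) (stateOf 1 uc θc) := by
        rw [hid]; exact add_nonneg (mul_nonneg hV0.le hconf) hkin
      exact nonneg_of_mul_nonneg_right this hV0 |> fun h => by nlinarith [this, hV0]
    have hgy : g y = relEnt σ (bU (boxKernel ℓ) z y) (stateOf 1 uc θc) := max_eq_right hrel
    have hM3 : γ' * ((N : ℝ) + 1) / (M : ℝ) ^ 3 = γ' * V := by
      rw [hV, hℓM, inv_pow]; ring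
    rw [hM3, hgy, show γ' * V * relEnt σ (bU (boxKernel ℓ) z y) (stateOf 1 uc θc) =
      γ' * V * confRate σ uc θc ((cellCount ℓ z y : ℝ) / V) + γ' * cellKin uc θc ℓ z y by
        rw [mul_assoc, hid]; ring, Real.exp_add, ENNReal.ofReal_mul (Real.exp_pos _).le]
  calc ENNReal.ofReal (Real.exp (γ' * ((N : ℝ) + 1) *
        ∫ x, max 0 (relEnt σ (bU (boxKernel ℓ ⋆ (Torus.kernel (ℓ / 8) : T3 → ℝ)) z x) (stateOf 1 uc θc))))
      ≤ ENNReal.ofReal (Real.exp (γ' * ((N : ℝ) + 1) * ∫ x, g x)) :=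
        ENNReal.ofReal_le_ofReal (Real.exp_le_exp.2 (mul_le_mul_of_nonneg_left hJ (by positivity)))
    _ ≤ ∫⁻ x, ∏ κ : Fin 3 → Fin M, ENNReal.ofReal (Real.exp (γ' * ((N : ℝ) + 1) / (M : ℝ) ^ 3 *
        g (x + Torus.proj (Torus.cellCorner M κ)))) := hT
    _ = _ := lintegral_congr fun x => Finset.prod_congr rfl fun κ _ => key _

end BlockMGFTwoScale

end Barycentric

end Summit.AtomisticToContinuum.HydrodynamicLimit.Theorems.MacroClosureLine

end
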